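import Literature.NumberTheory.Automorphic.CDTTheorem712
import Literature.NumberTheory.EllipticCurves.ModFiveCongruenceHesseFamily
import Literature.NumberTheory.EllipticCurves.GaloisActionProofs
import Literature.NumberTheory.GaloisRepresentations.AbsGaloisGroup
import HarnessLib

/-!
# stub-ideation k2 · GENERATION 12 (FAMILY 2 — RESHAPE) — `stub_switch`, crux `FreyModularity`
# PART B: THE LINEAR FRAME, RIGIDITY ALONG FISHER'S SEGMENT, AND THE ASSEMBLY TO F1 (`c₆ ≠ 0`)

Companion of `STUB-IDEAS-stub_switch-2.md` and of PART A `STUB_IDEAS_stub_switch_2g12_Table.lean`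
(Klein's section table `kleinTable` and `kleinTable_frameCertified : kleinTable.FrameCertified`,
38 kernel-checked certificates, 0 sorry, commit e757db280ae7).  Same namespace as PART A; §A1–§A2
below are CHARACTER-IDENTICAL copies of PART A §1, §5 (structure) and §6 (structure) — crux workfiles
cannot import each other, so the final join is the mechanical concatenation PART A ++ PART B minus
§A1–§A2 (exactly as k3-g11's Road joined two workfiles).

STATE OF PLAY.  `stub_switch ↔ CDT_three_five_switch` (`Iff.rfl`, `Lines/Sketch.lean`); k3-g11's Road
`CDT_three_five_switch_of_thm132 : F1 → CDT_three_five_switch` is kernel-checked (0 sorry) and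
consumes F1 := `thm132_geomTorsionFive_of_hesseFamily` ONLY at `c₆ ≠ 0` (`hF (base c₄ c₆) E' c₄ c₆ t 1
rfl rfl` inside `stub_switch_of_core_and_tail`, branch `hc₆ : c₆ ≠ 0`).  So the stub is
`F1ne` (F1 with the extra binder `c₆ ≠ 0`, §B9) — and THIS FILE PROVES `F1ne` from
  (T)  `∃ T : SectionTable, T.FrameCertified`          — PART A, PROVED (0 sorry);
  (P1) `L84C4`  Fisher L. 8.4 for `𝔠₄` over `ℚ̄`       — PROVED k3-g9/g10/g11 `lemma84_C4` (verbatim available);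
  (P2) `L84D`   Fisher L. 8.4 for `𝔇`                  — PROVED k3-g9 `lemma84_D` (`ring`, 20 s);
  (P3) `TorsorPoint` Klein's form problem is solvable  — PROVED k3-g10 `exists_torsorPoint`;
  (P4) `HesseSyzygy` `𝔠₄³ − 𝔠₆² = (c₄³ − c₆²)𝔇⁵`      — PART C `STUB_IDEAS_stub_switch_2g12_Hesse.lean`
                                                         (`hesse_syzygy₂`, 2 variables, `field_simp; ring`;
                                                         k3-g9 proved `μ = 1` in 70 s).
Everything else — the frame, the level structure, Galois rigidity, additivity, equivariance, the SIGN
of `𝔠₆` along the segment (replacing k3-g12's open `L84C6`), ellipticity of the models, the assembly —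
is PROVED below: `F1ne_of_frame : (∃ T, T.FrameCertified) → L84C4 → L84D → TorsorPoint →
HesseSyzygy → F1ne` (0 sorry, farm rc 0), and `stub_switch_of_frame` feeds it to the Road.
FINAL JOIN (mechanical, one prover cycle): Road (k3-g11, 0 sorry; change ONE binder: pass `hc₆` to
`hF`) ++ PART A ++ PART C ++ PART B; discharge (P1)–(P3) by the Road's `lemma84_C4`, `lemma84_D`,
`exists_torsorPoint` (their `kC4/kC6/kD/Mv1/Mv2` bodies are character-identical to §A1, so `exact`
elaborates by `δ`), (P4) by `hesseSyzygy_holds`, (T) by `table_frameCertified`.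

THE MOVE (reshape of k3-g12/13).  k3-g12 asked for a `Certified` table (~200 certificates incl. `ndgX`
over all 66 label pairs and a 24-case additivity-by-rigidity (`chord_rigid`, L3/L4 open)).  Here the
table enters only through a LINEAR FRAME `φ : 𝔽₅² →+ E(ℚ̄)` built from the two generators by Mathlib's
group law (`ZMod.lift` on each axis + `AddMonoidHom.coprod`; 38 certificates suffice: tangent at the
generators, the chords `2g+g`, `(i,0)+(0,j)` for `i ∈ {1,2}`, signs, and `(3,·),(4,·)` by `φ(−x) = −φ x`).
Additivity and injectivity are then FREE; `#E[5] = 25` (tree `card_torsionPoints_eq_sq_holds`) makes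
`φ` a level structure; Galois rigidity along the segment (k3-g12's PROVED engine, verbatim) makes the
relabelling `σ ↦ (x ↦ y)` the same at `t = 0` and `t = 1`; `e := φ₀ ∘ φ₁⁻¹` is the congruence.
-/

set_option linter.style.longLine false
set_option linter.unusedVariables false
set_option linter.dupNamespace false
set_option linter.style.setOption false
set_option linter.unusedSimpArgs false
set_option linter.unusedSectionVars false

namespace Summit.ABC.ABC.Cruxes.FreyModularity.StubSwitchK2g12

open Literature.NumberTheory.EllipticCurves Literature.NumberTheory.EllipticCurves.HesseFamilyFive
open Literature.NumberTheory.Automorphic Literature.NumberTheory.Automorphic.BCDT WeierstrassCurve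
open Polynomial
open scoped Classical

local notation "𝕃" => AlgebraicClosure ℚ

noncomputable section

/-! ## §1 Klein's icosahedral forms (VERBATIM k3-g9/k2-g10/k3-g12 §1; `CommRing`-polymorphic) -/

section Klein
variable {R : Type*} [CommRing R]

def kD (a b : R) : R := a ^ 11 * b - 11 * a ^ 6 * b ^ 6 - a * b ^ 11
def kDa (a b : R) : R := 11 * a ^ 10 * b - 66 * a ^ 5 * b ^ 6 - b ^ 11
def kDb (a b : R) : R := a ^ 11 - 66 * a ^ 6 * b ^ 5 - 11 * a * b ^ 10
def kC4 (a b : R) : R :=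
  a ^ 20 + 228 * a ^ 15 * b ^ 5 + 494 * a ^ 10 * b ^ 10 - 228 * a ^ 5 * b ^ 15 + b ^ 20
def kC6 (a b : R) : R :=
  -a ^ 30 + 522 * a ^ 25 * b ^ 5 + 10005 * a ^ 20 * b ^ 10 + 10005 * a ^ 10 * b ^ 20
    - 522 * a ^ 5 * b ^ 25 - b ^ 30
def Mv1 (a b l m : R) : R := l * a - m * kDb a b
def Mv2 (a b l m : R) : R := l * b + m * kDa a b

/-- Klein's syzygy `c₄³ − c₆² = 1728·D⁵`. -/
theorem klein_syzygy (a b : R) : kC4 a b ^ 3 - kC6 a b ^ 2 = 1728 * kD a b ^ 5 := by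
  simp only [kC4, kC6, kD]; ring

theorem map_kC4 {S : Type*} [CommRing S] (f : R →+* S) (a b : R) :
    f (kC4 a b) = kC4 (f a) (f b) := by simp only [kC4, map_add, map_sub, map_mul, map_pow, map_ofNat]
theorem map_kC6 {S : Type*} [CommRing S] (f : R →+* S) (a b : R) :
    f (kC6 a b) = kC6 (f a) (f b) := by
  simp only [kC6, map_add, map_sub, map_mul, map_pow, map_neg, map_ofNat]
theorem map_kD {S : Type*} [CommRing S] (f : R →+* S) (a b : R) :
    f (kD a b) = kD (f a) (f b) := by simp only [kD, map_sub, map_mul, map_pow, map_ofNat]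

end Klein

/-! ## §A2 The section-table interface and its frame certificate (VERBATIM PART A §5–§6) -/

/-- VERBATIM k3-g12 §2: a section table is a pair of polynomial laws natural in the ring. -/
structure SectionTable where
  X : ZMod 5 × ZMod 5 → ∀ (R : Type) [CommRing R], R → R → R → R
  Y : ZMod 5 × ZMod 5 → ∀ (R : Type) [CommRing R], R → R → R → R
  map_X : ∀ (x : ZMod 5 × ZMod 5) (R S : Type) [CommRing R] [CommRing S] (φ : R →+* S)
    (z a b : R), φ (X x R z a b) = X x S (φ z) (φ a) (φ b)
  map_Y : ∀ (x : ZMod 5 × ZMod 5) (R S : Type) [CommRing R] [CommRing S] (φ : R →+* S)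
    (z a b : R), φ (Y x R z a b) = Y x S (φ z) (φ a) (φ b)


/-- The frame certificate of a section table (integer model `y² = x³ − 27·5⁴·kC4·x − 54·5⁶·kC6`,
`hz : Φ₅(z) = 0`). -/
structure SectionTable.FrameCertified (T : SectionTable) : Prop where
  sign_X : ∀ (x : ZMod 5 × ZMod 5) (R : Type) [CommRing R] (z a b : R),
    T.X (-x) R z a b = T.X x R z a b
  sign_Y : ∀ (x : ZMod 5 × ZMod 5) (R : Type) [CommRing R] (z a b : R),
    T.Y (-x) R z a b = -T.Y x R z a b
  onCurve₁ : ∀ (F : Type) [Field F] [CharZero F] (z a b : F), z ^ 4 + z ^ 3 + z ^ 2 + z + 1 = 0 →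
    T.Y (1, 0) F z a b ^ 2 =
      T.X (1, 0) F z a b ^ 3 - 27 * 5 ^ 4 * kC4 a b * T.X (1, 0) F z a b - 54 * 5 ^ 6 * kC6 a b
  onCurve₂ : ∀ (F : Type) [Field F] [CharZero F] (z a b : F), z ^ 4 + z ^ 3 + z ^ 2 + z + 1 = 0 →
    T.Y (0, 1) F z a b ^ 2 =
      T.X (0, 1) F z a b ^ 3 - 27 * 5 ^ 4 * kC4 a b * T.X (0, 1) F z a b - 54 * 5 ^ 6 * kC6 a b
  dblX₁ : ∀ (F : Type) [Field F] [CharZero F] (z a b : F), z ^ 4 + z ^ 3 + z ^ 2 + z + 1 = 0 →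
    (T.X (2, 0) F z a b + 2 * T.X (1, 0) F z a b) * (2 * T.Y (1, 0) F z a b) ^ 2 =
      (3 * T.X (1, 0) F z a b ^ 2 - 27 * 5 ^ 4 * kC4 a b) ^ 2
  dblY₁ : ∀ (F : Type) [Field F] [CharZero F] (z a b : F), z ^ 4 + z ^ 3 + z ^ 2 + z + 1 = 0 →
    (T.Y (2, 0) F z a b + T.Y (1, 0) F z a b) * (2 * T.Y (1, 0) F z a b) =
      (3 * T.X (1, 0) F z a b ^ 2 - 27 * 5 ^ 4 * kC4 a b) * (T.X (1, 0) F z a b - T.X (2, 0) F z a b)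
  dblX₂ : ∀ (F : Type) [Field F] [CharZero F] (z a b : F), z ^ 4 + z ^ 3 + z ^ 2 + z + 1 = 0 →
    (T.X (0, 2) F z a b + 2 * T.X (0, 1) F z a b) * (2 * T.Y (0, 1) F z a b) ^ 2 =
      (3 * T.X (0, 1) F z a b ^ 2 - 27 * 5 ^ 4 * kC4 a b) ^ 2
  dblY₂ : ∀ (F : Type) [Field F] [CharZero F] (z a b : F), z ^ 4 + z ^ 3 + z ^ 2 + z + 1 = 0 →
    (T.Y (0, 2) F z a b + T.Y (0, 1) F z a b) * (2 * T.Y (0, 1) F z a b) =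
      (3 * T.X (0, 1) F z a b ^ 2 - 27 * 5 ^ 4 * kC4 a b) * (T.X (0, 1) F z a b - T.X (0, 2) F z a b)
  ndgY₁ : ∀ (F : Type) [Field F] [CharZero F] (z a b : F), z ^ 4 + z ^ 3 + z ^ 2 + z + 1 = 0 →
    kD a b ≠ 0 → T.Y (1, 0) F z a b ≠ 0
  ndgY₂ : ∀ (F : Type) [Field F] [CharZero F] (z a b : F), z ^ 4 + z ^ 3 + z ^ 2 + z + 1 = 0 →
    kD a b ≠ 0 → T.Y (0, 1) F z a b ≠ 0
  chordX₁ : ∀ (F : Type) [Field F] [CharZero F] (z a b : F), z ^ 4 + z ^ 3 + z ^ 2 + z + 1 = 0 →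
    (T.X (3, 0) F z a b + T.X (2, 0) F z a b + T.X (1, 0) F z a b) *
        (T.X (2, 0) F z a b - T.X (1, 0) F z a b) ^ 2 = (T.Y (2, 0) F z a b - T.Y (1, 0) F z a b) ^ 2
  chordY₁ : ∀ (F : Type) [Field F] [CharZero F] (z a b : F), z ^ 4 + z ^ 3 + z ^ 2 + z + 1 = 0 →
    (T.Y (3, 0) F z a b + T.Y (2, 0) F z a b) * (T.X (2, 0) F z a b - T.X (1, 0) F z a b) =
      (T.Y (2, 0) F z a b - T.Y (1, 0) F z a b) * (T.X (2, 0) F z a b - T.X (3, 0) F z a b)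
  ndgX₁ : ∀ (F : Type) [Field F] [CharZero F] (z a b : F), z ^ 4 + z ^ 3 + z ^ 2 + z + 1 = 0 →
    kD a b ≠ 0 → T.X (2, 0) F z a b ≠ T.X (1, 0) F z a b
  chordX₂ : ∀ (F : Type) [Field F] [CharZero F] (z a b : F), z ^ 4 + z ^ 3 + z ^ 2 + z + 1 = 0 →
    (T.X (0, 3) F z a b + T.X (0, 2) F z a b + T.X (0, 1) F z a b) *
        (T.X (0, 2) F z a b - T.X (0, 1) F z a b) ^ 2 = (T.Y (0, 2) F z a b - T.Y (0, 1) F z a b) ^ 2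
  chordY₂ : ∀ (F : Type) [Field F] [CharZero F] (z a b : F), z ^ 4 + z ^ 3 + z ^ 2 + z + 1 = 0 →
    (T.Y (0, 3) F z a b + T.Y (0, 2) F z a b) * (T.X (0, 2) F z a b - T.X (0, 1) F z a b) =
      (T.Y (0, 2) F z a b - T.Y (0, 1) F z a b) * (T.X (0, 2) F z a b - T.X (0, 3) F z a b)
  ndgX₂ : ∀ (F : Type) [Field F] [CharZero F] (z a b : F), z ^ 4 + z ^ 3 + z ^ 2 + z + 1 = 0 →
    kD a b ≠ 0 → T.X (0, 2) F z a b ≠ T.X (0, 1) F z a b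
  crossX₁ : ∀ (j : ZMod 5), j ≠ 0 → ∀ (F : Type) [Field F] [CharZero F] (z a b : F),
    z ^ 4 + z ^ 3 + z ^ 2 + z + 1 = 0 →
      (T.X (1, j) F z a b + T.X (1, 0) F z a b + T.X (0, j) F z a b) *
        (T.X (1, 0) F z a b - T.X (0, j) F z a b) ^ 2 = (T.Y (1, 0) F z a b - T.Y (0, j) F z a b) ^ 2
  crossY₁ : ∀ (j : ZMod 5), j ≠ 0 → ∀ (F : Type) [Field F] [CharZero F] (z a b : F),
    z ^ 4 + z ^ 3 + z ^ 2 + z + 1 = 0 →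
      (T.Y (1, j) F z a b + T.Y (1, 0) F z a b) * (T.X (1, 0) F z a b - T.X (0, j) F z a b) =
        (T.Y (1, 0) F z a b - T.Y (0, j) F z a b) * (T.X (1, 0) F z a b - T.X (1, j) F z a b)
  crossNdgX₁ : ∀ (j : ZMod 5), j ≠ 0 → ∀ (F : Type) [Field F] [CharZero F] (z a b : F),
    z ^ 4 + z ^ 3 + z ^ 2 + z + 1 = 0 → kD a b ≠ 0 → T.X (1, 0) F z a b ≠ T.X (0, j) F z a b
  crossX₂ : ∀ (j : ZMod 5), j ≠ 0 → ∀ (F : Type) [Field F] [CharZero F] (z a b : F),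
    z ^ 4 + z ^ 3 + z ^ 2 + z + 1 = 0 →
      (T.X (2, j) F z a b + T.X (2, 0) F z a b + T.X (0, j) F z a b) *
        (T.X (2, 0) F z a b - T.X (0, j) F z a b) ^ 2 = (T.Y (2, 0) F z a b - T.Y (0, j) F z a b) ^ 2
  crossY₂ : ∀ (j : ZMod 5), j ≠ 0 → ∀ (F : Type) [Field F] [CharZero F] (z a b : F),
    z ^ 4 + z ^ 3 + z ^ 2 + z + 1 = 0 →
      (T.Y (2, j) F z a b + T.Y (2, 0) F z a b) * (T.X (2, 0) F z a b - T.X (0, j) F z a b) =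
        (T.Y (2, 0) F z a b - T.Y (0, j) F z a b) * (T.X (2, 0) F z a b - T.X (2, j) F z a b)
  crossNdgX₂ : ∀ (j : ZMod 5), j ≠ 0 → ∀ (F : Type) [Field F] [CharZero F] (z a b : F),
    z ^ 4 + z ^ 3 + z ^ 2 + z + 1 = 0 → kD a b ≠ 0 → T.X (2, 0) F z a b ≠ T.X (0, j) F z a b


/-! ## §B1 Chord, tangent and sign with denominators cleared (generic Mathlib group law; PROVED) -/

section Generic
variable {K : Type*} [Field K] [DecidableEq K]

/-- transport of a nonsingular point along coordinate equalities. -/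
theorem some_congr {E : Affine K} {x y x' y' : K} (n : E.Nonsingular x y) (hx : x = x') (hy : y = y') :
    ∃ n', Affine.Point.some x y n = Affine.Point.some x' y' n' := by
  subst hx; subst hy; exact ⟨n, rfl⟩

/-- `P₁ + P₂ = (x₃, y₃)` from the two CHORD identities (Mathlib's `addX/addY` with denominators
cleared), on a curve with `a₁ = a₂ = a₃ = 0`; the sum is automatically nonsingular. -/
theorem add_eq_of_chord {E : Affine K} (h₁ : E.a₁ = 0) (h₂ : E.a₂ = 0) (h₃ : E.a₃ = 0)
    {x₁ y₁ x₂ y₂ x₃ y₃ : K} {n₁ : E.Nonsingular x₁ y₁} {n₂ : E.Nonsingular x₂ y₂} (hx : x₁ ≠ x₂)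
    (cX : (x₃ + x₁ + x₂) * (x₁ - x₂) ^ 2 = (y₁ - y₂) ^ 2)
    (cY : (y₃ + y₁) * (x₁ - x₂) = (y₁ - y₂) * (x₁ - x₃)) :
    ∃ n₃, Affine.Point.some x₁ y₁ n₁ + Affine.Point.some x₂ y₂ n₂ = Affine.Point.some x₃ y₃ n₃ := by
  have hsub : x₁ - x₂ ≠ 0 := sub_ne_zero.mpr hx
  have hsq : ((y₁ - y₂) / (x₁ - x₂)) ^ 2 = x₃ + x₁ + x₂ := by
    rw [div_pow, div_eq_iff (pow_ne_zero 2 hsub)]; exact cX.symm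
  have ex : E.addX x₁ x₂ (E.slope x₁ x₂ y₁ y₂) = x₃ := by
    rw [Affine.slope_of_X_ne hx, Affine.addX, hsq, h₁, h₂]; ring
  have hl : (y₁ - y₂) / (x₁ - x₂) * (x₃ - x₁) = -(y₃ + y₁) := by
    rw [div_mul_eq_mul_div, div_eq_iff hsub]; linear_combination cY
  have ey : E.addY x₁ x₂ y₁ (E.slope x₁ x₂ y₁ y₂) = y₃ := by
    rw [Affine.addY, Affine.negAddY, ex, Affine.negY, Affine.slope_of_X_ne hx, hl, h₁, h₃]; ring
  rw [Affine.Point.add_of_X_ne hx]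
  exact some_congr _ ex ey

/-- `P₁ + P₁ = (x₃, y₃)` from the two TANGENT identities (`a₁ = a₂ = a₃ = 0`, `y₁ ≠ 0`, char `0`). -/
theorem two_eq_of_tangent [CharZero K] {E : Affine K} (h₁ : E.a₁ = 0) (h₂ : E.a₂ = 0) (h₃ : E.a₃ = 0)
    {x₁ y₁ x₃ y₃ : K} {n₁ : E.Nonsingular x₁ y₁} (hy : y₁ ≠ 0)
    (dX : (x₃ + 2 * x₁) * (2 * y₁) ^ 2 = (3 * x₁ ^ 2 + E.a₄) ^ 2)
    (dY : (y₃ + y₁) * (2 * y₁) = (3 * x₁ ^ 2 + E.a₄) * (x₁ - x₃)) :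
    ∃ n₃, Affine.Point.some x₁ y₁ n₁ + Affine.Point.some x₁ y₁ n₁ = Affine.Point.some x₃ y₃ n₃ := by
  have h2y : (2 : K) * y₁ ≠ 0 := mul_ne_zero two_ne_zero hy
  have hneg : E.negY x₁ y₁ = -y₁ := by rw [Affine.negY, h₁, h₃]; ring
  have hy' : y₁ ≠ E.negY x₁ y₁ := by
    rw [hneg]; intro h; apply h2y; linear_combination h
  have hs : E.slope x₁ x₁ y₁ y₁ = (3 * x₁ ^ 2 + E.a₄) / (2 * y₁) := by
    rw [Affine.slope_of_Y_ne rfl hy', hneg, h₁, h₂]; ring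
  have hsq : ((3 * x₁ ^ 2 + E.a₄) / (2 * y₁)) ^ 2 = x₃ + 2 * x₁ := by
    rw [div_pow, div_eq_iff (pow_ne_zero 2 h2y)]; exact dX.symm
  have ex : E.addX x₁ x₁ (E.slope x₁ x₁ y₁ y₁) = x₃ := by
    rw [hs, Affine.addX, hsq, h₁, h₂]; ring
  have hl : (3 * x₁ ^ 2 + E.a₄) / (2 * y₁) * (x₃ - x₁) = -(y₃ + y₁) := by
    rw [div_mul_eq_mul_div, div_eq_iff h2y]; linear_combination dY
  have ey : E.addY x₁ x₁ y₁ (E.slope x₁ x₁ y₁ y₁) = y₃ := by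
    rw [Affine.addY, Affine.negAddY, ex, Affine.negY, hs, hl, h₁, h₃]; ring
  rw [Affine.Point.add_self_of_Y_ne hy']
  exact some_congr _ ex ey

/-- `-P = (x', y')` when `x' = x`, `y' = -y` (`a₁ = a₃ = 0`). -/
theorem neg_eq_of_sign {E : Affine K} (h₁ : E.a₁ = 0) (h₃ : E.a₃ = 0)
    {x₁ y₁ x₂ y₂ : K} {n₁ : E.Nonsingular x₁ y₁} (sX : x₂ = x₁) (sY : y₂ = -y₁) :
    ∃ n₂, -Affine.Point.some x₁ y₁ n₁ = Affine.Point.some x₂ y₂ n₂ := by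
  rw [Affine.Point.neg_some]
  exact some_congr _ sX.symm (by rw [sY, Affine.negY, h₁, h₃]; ring)

/-! ## §B2 The LINEAR FRAME `φ : 𝔽₅² →+ E(K)` through a table with the chain identities (PROVED) -/

/-- The identities a `K`-valued table `(X_x, Y_x)_{x ∈ 𝔽₅²}` must satisfy for the frame argument
(the fields of `SectionTable.FrameCertified`, evaluated at a Klein model; see `frameIdentities_of`). -/
structure FrameIdentities (E : Affine K) (X Y : ZMod 5 × ZMod 5 → K) : Prop where
  sign_X : ∀ x, X (-x) = X x
  sign_Y : ∀ x, Y (-x) = -Y x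
  ns₁ : E.Nonsingular (X (1, 0)) (Y (1, 0))
  ns₂ : E.Nonsingular (X (0, 1)) (Y (0, 1))
  dblX₁ : (X (2, 0) + 2 * X (1, 0)) * (2 * Y (1, 0)) ^ 2 = (3 * X (1, 0) ^ 2 + E.a₄) ^ 2
  dblY₁ : (Y (2, 0) + Y (1, 0)) * (2 * Y (1, 0)) = (3 * X (1, 0) ^ 2 + E.a₄) * (X (1, 0) - X (2, 0))
  dblX₂ : (X (0, 2) + 2 * X (0, 1)) * (2 * Y (0, 1)) ^ 2 = (3 * X (0, 1) ^ 2 + E.a₄) ^ 2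
  dblY₂ : (Y (0, 2) + Y (0, 1)) * (2 * Y (0, 1)) = (3 * X (0, 1) ^ 2 + E.a₄) * (X (0, 1) - X (0, 2))
  ndgY₁ : Y (1, 0) ≠ 0
  ndgY₂ : Y (0, 1) ≠ 0
  chordX₁ : (X (3, 0) + X (2, 0) + X (1, 0)) * (X (2, 0) - X (1, 0)) ^ 2 = (Y (2, 0) - Y (1, 0)) ^ 2
  chordY₁ : (Y (3, 0) + Y (2, 0)) * (X (2, 0) - X (1, 0)) = (Y (2, 0) - Y (1, 0)) * (X (2, 0) - X (3, 0))
  ndgX₁ : X (2, 0) ≠ X (1, 0)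
  chordX₂ : (X (0, 3) + X (0, 2) + X (0, 1)) * (X (0, 2) - X (0, 1)) ^ 2 = (Y (0, 2) - Y (0, 1)) ^ 2
  chordY₂ : (Y (0, 3) + Y (0, 2)) * (X (0, 2) - X (0, 1)) = (Y (0, 2) - Y (0, 1)) * (X (0, 2) - X (0, 3))
  ndgX₂ : X (0, 2) ≠ X (0, 1)
  crossX : ∀ i j : ZMod 5, (i = 1 ∨ i = 2) → j ≠ 0 →
    (X (i, j) + X (i, 0) + X (0, j)) * (X (i, 0) - X (0, j)) ^ 2 = (Y (i, 0) - Y (0, j)) ^ 2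
  crossY : ∀ i j : ZMod 5, (i = 1 ∨ i = 2) → j ≠ 0 →
    (Y (i, j) + Y (i, 0)) * (X (i, 0) - X (0, j)) = (Y (i, 0) - Y (0, j)) * (X (i, 0) - X (i, j))
  crossNdgX : ∀ i j : ZMod 5, (i = 1 ∨ i = 2) → j ≠ 0 → X (i, 0) ≠ X (0, j)

/-- One axis of the frame: from `P₁ + P₁ = P₂`, `P₂ + P₁ = P₃`, `−P₂ = P₃`, `−P₁ = P₄` get
`f : ZMod 5 →+ A` through the four points (`ZMod.lift`). -/
theorem axis_frame {A : Type*} [AddCommGroup A] (P₁ P₂ P₃ P₄ : A)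
    (h2 : P₁ + P₁ = P₂) (h3 : P₂ + P₁ = P₃) (hn2 : -P₂ = P₃) (hn1 : -P₁ = P₄) :
    ∃ f : ZMod 5 →+ A, f 1 = P₁ ∧ f 2 = P₂ ∧ f 3 = P₃ ∧ f 4 = P₄ := by
  have h5 : (zmultiplesHom A P₁) (5 : ℕ) = 0 := by
    simp only [zmultiplesHom_apply]
    rw [show ((5 : ℕ) : ℤ) = 2 + 2 + 1 from rfl, add_zsmul, add_zsmul, one_zsmul, two_zsmul, h2,
      add_assoc, h3, ← hn2, add_neg_cancel]
  set f : ZMod 5 →+ A := ZMod.lift 5 ⟨zmultiplesHom A P₁, h5⟩ with hf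
  have e1 : f 1 = P₁ := by
    have := ZMod.lift_coe 5 ⟨zmultiplesHom A P₁, h5⟩ 1
    simpa using this
  have e2 : f 2 = P₂ :=
    calc f 2 = f (1 + 1) := rfl
      _ = P₁ + P₁ := by rw [map_add, e1]
      _ = P₂ := h2
  have e3 : f 3 = P₃ :=
    calc f 3 = f (2 + 1) := rfl
      _ = P₂ + P₁ := by rw [map_add, e1, e2]
      _ = P₃ := h3
  have e4 : f 4 = P₄ :=
    calc f 4 = f (-1) := rfl
      _ = -P₁ := by rw [map_neg, e1]
      _ = P₄ := hn1
  exact ⟨f, e1, e2, e3, e4⟩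

/-- the four non-zero residues mod `5` up to sign. -/
theorem zmod5_cases : ∀ i : ZMod 5, i ≠ 0 → i = 1 ∨ i = 2 ∨ -i = 1 ∨ -i = 2 := by decide

/-- **THE FRAME (PROVED).** A table with the chain identities is the image of an ADDITIVE map
`φ : 𝔽₅² →+ E(K)`: `φ x = (X_x, Y_x)` for every `x ≠ 0` (so additivity of the level structure is free). -/
theorem frame_exists [CharZero K] {E : Affine K} (h₁ : E.a₁ = 0) (h₂ : E.a₂ = 0) (h₃ : E.a₃ = 0)
    {X Y : ZMod 5 × ZMod 5 → K} (hF : FrameIdentities E X Y) :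
    ∃ φ : ZMod 5 × ZMod 5 →+ E.Point,
      ∀ x : ZMod 5 × ZMod 5, x ≠ 0 → ∃ n, φ x = Affine.Point.some (X x) (Y x) n := by
  classical
  -- axis 1: the points `P₁ … P₄ = (X (k,0), Y (k,0))`
  obtain ⟨n₂, e₂⟩ := two_eq_of_tangent h₁ h₂ h₃ (n₁ := hF.ns₁) hF.ndgY₁ hF.dblX₁ hF.dblY₁
  obtain ⟨n₃, e₃⟩ := add_eq_of_chord h₁ h₂ h₃ (n₁ := n₂) (n₂ := hF.ns₁) hF.ndgX₁ hF.chordX₁ hF.chordY₁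
  obtain ⟨n₃', e₃'⟩ := neg_eq_of_sign h₁ h₃ (n₁ := n₂) (x₂ := X (3, 0)) (y₂ := Y (3, 0))
    (by have := hF.sign_X (2, 0); exact this) (by have := hF.sign_Y (2, 0); exact this)
  obtain ⟨n₄, e₄⟩ := neg_eq_of_sign h₁ h₃ (n₁ := hF.ns₁) (x₂ := X (4, 0)) (y₂ := Y (4, 0))
    (by have := hF.sign_X (1, 0); exact this) (by have := hF.sign_Y (1, 0); exact this)
  have e₃'' : -Affine.Point.some (X (2, 0)) (Y (2, 0)) n₂ = Affine.Point.some (X (3, 0)) (Y (3, 0)) n₃ := by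
    rw [e₃']
  obtain ⟨f₁, f₁1, f₁2, f₁3, f₁4⟩ := axis_frame _ _ _ _ e₂ e₃ e₃'' e₄
  -- axis 2
  obtain ⟨m₂, d₂⟩ := two_eq_of_tangent h₁ h₂ h₃ (n₁ := hF.ns₂) hF.ndgY₂ hF.dblX₂ hF.dblY₂
  obtain ⟨m₃, d₃⟩ := add_eq_of_chord h₁ h₂ h₃ (n₁ := m₂) (n₂ := hF.ns₂) hF.ndgX₂ hF.chordX₂ hF.chordY₂
  obtain ⟨m₃', d₃'⟩ := neg_eq_of_sign h₁ h₃ (n₁ := m₂) (x₂ := X (0, 3)) (y₂ := Y (0, 3))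
    (by have := hF.sign_X (0, 2); exact this) (by have := hF.sign_Y (0, 2); exact this)
  obtain ⟨m₄, d₄⟩ := neg_eq_of_sign h₁ h₃ (n₁ := hF.ns₂) (x₂ := X (0, 4)) (y₂ := Y (0, 4))
    (by have := hF.sign_X (0, 1); exact this) (by have := hF.sign_Y (0, 1); exact this)
  have d₃'' : -Affine.Point.some (X (0, 2)) (Y (0, 2)) m₂ = Affine.Point.some (X (0, 3)) (Y (0, 3)) m₃ := by
    rw [d₃']
  obtain ⟨f₂, f₂1, f₂2, f₂3, f₂4⟩ := axis_frame _ _ _ _ d₂ d₃ d₃'' d₄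
  -- the axes carry the table
  have hax₁ : ∀ i : ZMod 5, i ≠ 0 → ∃ n, f₁ i = Affine.Point.some (X (i, 0)) (Y (i, 0)) n := by
    intro i hi
    rcases zmod5_cases i hi with rfl | rfl | h | h
    · exact ⟨_, f₁1⟩
    · exact ⟨_, f₁2⟩
    · obtain rfl : i = 4 := by revert h; decide +revert
      exact ⟨_, f₁4⟩
    · obtain rfl : i = 3 := by revert h; decide +revert
      exact ⟨_, f₁3⟩
  have hax₂ : ∀ j : ZMod 5, j ≠ 0 → ∃ n, f₂ j = Affine.Point.some (X (0, j)) (Y (0, j)) n := by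
    intro j hj
    rcases zmod5_cases j hj with rfl | rfl | h | h
    · exact ⟨_, f₂1⟩
    · exact ⟨_, f₂2⟩
    · obtain rfl : j = 4 := by revert h; decide +revert
      exact ⟨_, f₂4⟩
    · obtain rfl : j = 3 := by revert h; decide +revert
      exact ⟨_, f₂3⟩
  -- mixed labels with first coordinate `1` or `2`: one chord
  have hcross : ∀ i j : ZMod 5, (i = 1 ∨ i = 2) → j ≠ 0 →
      ∃ n, f₁ i + f₂ j = Affine.Point.some (X (i, j)) (Y (i, j)) n := by
    intro i j hi hj
    have hi0 : i ≠ 0 := by rcases hi with rfl | rfl <;> decide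
    obtain ⟨nᵢ, eᵢ⟩ := hax₁ i hi0
    obtain ⟨mⱼ, eⱼ⟩ := hax₂ j hj
    rw [eᵢ, eⱼ]
    exact add_eq_of_chord h₁ h₂ h₃ (hF.crossNdgX i j hi hj) (hF.crossX i j hi hj) (hF.crossY i j hi hj)
  refine ⟨f₁.coprod f₂, fun x hx => ?_⟩
  obtain ⟨i, j⟩ := x
  rw [AddMonoidHom.coprod_apply]
  by_cases hi : i = 0
  · subst hi
    have hj : j ≠ 0 := by rintro rfl; exact hx rfl
    rw [map_zero, zero_add]; exact hax₂ j hj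
  by_cases hj : j = 0
  · subst hj
    rw [map_zero, add_zero]; exact hax₁ i hi
  rcases zmod5_cases i hi with h | h | h | h
  · exact hcross i j (Or.inl h) hj
  · exact hcross i j (Or.inr h) hj
  all_goals
    obtain ⟨n, hn⟩ := hcross (-i) (-j) (by simp [h]) (neg_ne_zero.mpr hj)
    rw [map_neg, map_neg] at hn
    have hn' : f₁ i + f₂ j = -Affine.Point.some (X (-i, -j)) (Y (-i, -j)) n := by
      rw [← hn]; abel
    rw [hn']
    exact neg_eq_of_sign h₁ h₃
      (by have := hF.sign_X (-i, -j); simpa only [Prod.neg_mk, neg_neg] using this)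
      (by have := hF.sign_Y (-i, -j); simpa only [Prod.neg_mk, neg_neg] using this)

end Generic

/-! ## §B3 Klein models over `ℚ` and the frame identities at a torsor point (PROVED) -/

/-- The integer `c₄c₆`-model `y² = x³ − 27·5⁴·A·x − 54·5⁶·B` (`= ⟨5⁻¹,0,0,0⟩ • (y² = x³ − 27Ax − 54B)`,
tree `scale_smul_short 5`).  VERBATIM k3-g12. -/
abbrev sbase (A B : ℚ) : WeierstrassCurve ℚ := ⟨0, 0, 0, -(27 * 5 ^ 4) * A, -(54 * 5 ^ 6) * B⟩

/-- `W/ℚ` is the integer `c₄c₆`-model attached to the torsor point `(a,b) ∈ ℚ̄²`.  VERBATIM k3-g12. -/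
structure IsKleinModel (W : WeierstrassCurve ℚ) (a b : 𝕃) : Prop where
  ha₁ : W.a₁ = 0
  ha₂ : W.a₂ = 0
  ha₃ : W.a₃ = 0
  ha₄ : ((W.a₄ : ℚ) : 𝕃) = -(27 * 5 ^ 4) * kC4 a b
  ha₆ : ((W.a₆ : ℚ) : 𝕃) = -(54 * 5 ^ 6) * kC6 a b

/-- the coefficients of `W/ℚ̄` for a Klein model. -/
theorem IsKleinModel.coeffs {W : WeierstrassCurve ℚ} {a b : 𝕃} (hW : IsKleinModel W a b) :
    (W.baseChange 𝕃).toAffine.a₁ = 0 ∧ (W.baseChange 𝕃).toAffine.a₂ = 0 ∧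
      (W.baseChange 𝕃).toAffine.a₃ = 0 ∧ (W.baseChange 𝕃).toAffine.a₄ = -(27 * 5 ^ 4) * kC4 a b ∧
      (W.baseChange 𝕃).toAffine.a₆ = -(54 * 5 ^ 6) * kC6 a b := by
  refine ⟨?_, ?_, ?_, ?_, ?_⟩
  · show algebraMap ℚ 𝕃 W.a₁ = 0
    rw [hW.ha₁, map_zero]
  · show algebraMap ℚ 𝕃 W.a₂ = 0
    rw [hW.ha₂, map_zero]
  · show algebraMap ℚ 𝕃 W.a₃ = 0
    rw [hW.ha₃, map_zero]
  · show algebraMap ℚ 𝕃 W.a₄ = _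
    rw [eq_ratCast, hW.ha₄]
  · show algebraMap ℚ 𝕃 W.a₆ = _
    rw [eq_ratCast, hW.ha₆]

/-- **The frame identities at a Klein model (PROVED from the certificate).**  On-curve ⇒ nonsingular by
Mathlib's `equation_iff_nonsingular` (the model is elliptic). -/
theorem frameIdentities_of (T : SectionTable) (hT : T.FrameCertified) (W : WeierstrassCurve ℚ)
    [W.IsElliptic] {z a b : 𝕃} (hz : z ^ 4 + z ^ 3 + z ^ 2 + z + 1 = 0) (hW : IsKleinModel W a b)
    (hD : kD a b ≠ 0) :
    FrameIdentities (W.baseChange 𝕃).toAffine (fun x => T.X x 𝕃 z a b) (fun x => T.Y x 𝕃 z a b) := by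
  obtain ⟨h₁, h₂, h₃, h₄, h₆⟩ := hW.coeffs
  haveI : (W.baseChange 𝕃).IsElliptic := by unfold WeierstrassCurve.baseChange; infer_instance
  have ns : ∀ x y : 𝕃, y ^ 2 = x ^ 3 - 27 * 5 ^ 4 * kC4 a b * x - 54 * 5 ^ 6 * kC6 a b →
      (W.baseChange 𝕃).toAffine.Nonsingular x y := by
    intro x y h
    refine (Affine.equation_iff_nonsingular).mp ?_
    rw [Affine.equation_iff, h₁, h₂, h₃, h₄, h₆]
    linear_combination h
  exact
    { sign_X := fun x => hT.sign_X x 𝕃 z a b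
      sign_Y := fun x => hT.sign_Y x 𝕃 z a b
      ns₁ := ns _ _ (hT.onCurve₁ 𝕃 z a b hz)
      ns₂ := ns _ _ (hT.onCurve₂ 𝕃 z a b hz)
      dblX₁ := by rw [h₄]; linear_combination hT.dblX₁ 𝕃 z a b hz
      dblY₁ := by rw [h₄]; linear_combination hT.dblY₁ 𝕃 z a b hz
      dblX₂ := by rw [h₄]; linear_combination hT.dblX₂ 𝕃 z a b hz
      dblY₂ := by rw [h₄]; linear_combination hT.dblY₂ 𝕃 z a b hz
      ndgY₁ := hT.ndgY₁ 𝕃 z a b hz hD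
      ndgY₂ := hT.ndgY₂ 𝕃 z a b hz hD
      chordX₁ := hT.chordX₁ 𝕃 z a b hz
      chordY₁ := hT.chordY₁ 𝕃 z a b hz
      ndgX₁ := hT.ndgX₁ 𝕃 z a b hz hD
      chordX₂ := hT.chordX₂ 𝕃 z a b hz
      chordY₂ := hT.chordY₂ 𝕃 z a b hz
      ndgX₂ := hT.ndgX₂ 𝕃 z a b hz hD
      crossX := fun i j hi hj => by
        rcases hi with rfl | rfl
        · exact hT.crossX₁ j hj 𝕃 z a b hz
        · exact hT.crossX₂ j hj 𝕃 z a b hz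
      crossY := fun i j hi hj => by
        rcases hi with rfl | rfl
        · exact hT.crossY₁ j hj 𝕃 z a b hz
        · exact hT.crossY₂ j hj 𝕃 z a b hz
      crossNdgX := fun i j hi hj => by
        rcases hi with rfl | rfl
        · exact hT.crossNdgX₁ j hj 𝕃 z a b hz hD
        · exact hT.crossNdgX₂ j hj 𝕃 z a b hz hD }

/-! ## §B4 The level structure `φ : 𝔽₅² ≃ W[5]` (PROVED: frame + `#W[5] = 25`) -/

theorem five_smul_zmod5sq : ∀ x : ZMod 5 × ZMod 5, (5 : ℤ) • x = 0 := by decide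

/-- retype a frame of `W/ℚ̄` as valued in the synonym `geomPoints W` (definitional). -/
def toGeom (W : WeierstrassCurve ℚ) (φ : ZMod 5 × ZMod 5 →+ (W.baseChange 𝕃).toAffine.Point) :
    ZMod 5 × ZMod 5 →+ geomPoints W := φ

theorem toGeom_apply (W : WeierstrassCurve ℚ) (φ : ZMod 5 × ZMod 5 →+ (W.baseChange 𝕃).toAffine.Point)
    (x : ZMod 5 × ZMod 5) : (toGeom W φ x : geomPoints W) = (φ x : (W.baseChange 𝕃).toAffine.Point) := rfl

/-- **L1 · level_structure (PROVED).** At a torsor point with `D^{Kl} ≠ 0` a frame-certified table is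
an additive BIJECTION `φ : 𝔽₅² →+ W[5]` with `φ x = (X_x, Y_x)(ζ,a,b)` for `x ≠ 0`. -/
theorem level_structure (T : SectionTable) (hT : T.FrameCertified) (W : WeierstrassCurve ℚ)
    [W.IsElliptic] {z a b : 𝕃} (hz : z ^ 4 + z ^ 3 + z ^ 2 + z + 1 = 0) (hW : IsKleinModel W a b)
    (hD : kD a b ≠ 0) :
    ∃ φ : ZMod 5 × ZMod 5 →+ W.geomTorsion 5, Function.Bijective φ ∧
      ∀ x : ZMod 5 × ZMod 5, x ≠ 0 → ∃ n,
        ((φ x : W.geomTorsion 5) : geomPoints W) =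
          (Affine.Point.some (T.X x 𝕃 z a b) (T.Y x 𝕃 z a b) n : (W.baseChange 𝕃).toAffine.Point) := by
  classical
  obtain ⟨h₁, h₂, h₃, -, -⟩ := hW.coeffs
  obtain ⟨φ₀, hφ₀⟩ := frame_exists h₁ h₂ h₃ (frameIdentities_of T hT W hz hW hD)
  -- values are `5`-torsion
  have hmem : ∀ x, toGeom W φ₀ x ∈ W.geomTorsion 5 := by
    intro x
    have h5 : (5 : ℤ) • toGeom W φ₀ x = 0 := by
      rw [← map_zsmul (toGeom W φ₀), five_smul_zmod5sq, map_zero]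
    exact (Submodule.mem_torsionBy_iff (5 : ℤ) (toGeom W φ₀ x)).mpr h5
  let φ : ZMod 5 × ZMod 5 →+ W.geomTorsion 5 := AddMonoidHom.codRestrict (toGeom W φ₀) (W.geomTorsion 5) hmem
  have hφ : ∀ x, ((φ x : W.geomTorsion 5) : geomPoints W) = toGeom W φ₀ x := fun x => rfl
  -- injective: non-zero labels go to affine points
  have hinj : Function.Injective φ := by
    refine (injective_iff_map_eq_zero φ).mpr fun x hx => ?_
    by_contra hx0
    obtain ⟨n, hn⟩ := hφ₀ x hx0
    have h1 : ((φ x : W.geomTorsion 5) : geomPoints W) = 0 := by rw [hx]; rfl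
    have h2 : (φ₀ x : (W.baseChange 𝕃).toAffine.Point) = 0 := h1
    rw [hn] at h2
    exact Affine.Point.some_ne_zero n h2
  -- `#W[5] = 25`
  have hcard : Nat.card (W.geomTorsion 5) = 25 :=
    card_torsionPoints_eq_sq_holds W 𝕃 (n := 5) (by norm_num)
  haveI : Finite (W.geomTorsion 5) := Nat.finite_of_card_ne_zero (by rw [hcard]; norm_num)
  have hbij : Function.Bijective φ := by
    refine (Nat.bijective_iff_injective_and_card φ).mpr ⟨hinj, ?_⟩
    rw [hcard, Nat.card_prod, Nat.card_zmod]
  refine ⟨φ, hbij, fun x hx => ?_⟩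
  obtain ⟨n, hn⟩ := hφ₀ x hx
  exact ⟨n, hn⟩

/-- **L1b · relabel_at (PROVED).** `σ ∈ Aut(ℚ̄/ℚ)` permutes the non-zero labels of the level structure of
a `ℚ`-model: `σ(X_x, Y_x) = (X_y, Y_y)` for some `y ≠ 0` (`σ • φ x ∈ W[5] ∖ O` and `φ` is onto). -/
theorem relabel_at (T : SectionTable) (hT : T.FrameCertified) (W : WeierstrassCurve ℚ)
    [W.IsElliptic] {z a b : 𝕃} (hz : z ^ 4 + z ^ 3 + z ^ 2 + z + 1 = 0) (hW : IsKleinModel W a b)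
    (hD : kD a b ≠ 0) (σ : 𝕃 ≃ₐ[ℚ] 𝕃) (x : ZMod 5 × ZMod 5) (hx : x ≠ 0) :
    ∃ y : ZMod 5 × ZMod 5, y ≠ 0 ∧
      σ (T.X x 𝕃 z a b) = T.X y 𝕃 z a b ∧ σ (T.Y x 𝕃 z a b) = T.Y y 𝕃 z a b := by
  classical
  obtain ⟨φ, hbij, hφ⟩ := level_structure T hT W hz hW hD
  let τ : Field.absoluteGaloisGroup ℚ := σ
  obtain ⟨y, hy⟩ := hbij.2 (τ • φ x)
  have hy0 : y ≠ 0 := by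
    rintro rfl
    rw [map_zero] at hy
    have h0 : φ x = 0 := (smul_eq_zero_iff_eq τ).mp hy.symm
    exact hx (hbij.1 (by rw [h0, map_zero]))
  obtain ⟨n₁, e₁⟩ := hφ x hx
  obtain ⟨n₂, e₂⟩ := hφ y hy0
  have key : ((τ • φ x : W.geomTorsion 5) : geomPoints W) = (φ y : geomPoints W) := by rw [hy]
  rw [AddSubgroup.torsionBy.coe_smul, e₁, e₂] at key
  have key' : Affine.Point.map ((σ : 𝕃 ≃ₐ[ℚ] 𝕃) : 𝕃 →ₐ[ℚ] 𝕃)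
      (Affine.Point.some (T.X x 𝕃 z a b) (T.Y x 𝕃 z a b) n₁ : (W.baseChange 𝕃).toAffine.Point) =
      Affine.Point.some (T.X y 𝕃 z a b) (T.Y y 𝕃 z a b) n₂ := key
  rw [Affine.Point.map_some] at key'
  obtain ⟨hX, hY⟩ := Affine.Point.some.inj key'
  exact ⟨y, hy0, hX, hY⟩


/-! ## §B5 Rigidity along a segment (k3-g12 §1, §4 VERBATIM — PROVED there; `relabel_pointwise` now PROVED) -/

/-- **THE ENGINE (k3-g12, PROVED)** — if finitely many candidate identities between polynomials are such
that at each point of an infinite set SOME candidate holds, then ONE candidate holds identically. -/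
theorem rigidity_engine {L : Type*} [CommRing L] [IsDomain L] {Λ : Type*} [Finite Λ] {ι : Type*}
    (S : Set L) (hS : S.Infinite) (P : ι → L[X]) (Q : Λ → ι → L[X])
    (h : ∀ t ∈ S, ∃ y, ∀ i, (P i).eval t = (Q y i).eval t) : ∃ y, ∀ i, P i = Q y i := by
  classical
  haveI : Infinite S := hS.to_subtype
  choose f hf using fun t : S => h t.1 t.2
  obtain ⟨y, hy⟩ := Finite.exists_infinite_fiber f
  refine ⟨y, fun i => Polynomial.eq_of_infinite_eval_eq (P i) (Q y i) ?_⟩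
  have hinf : Set.Infinite (Subtype.val '' (f ⁻¹' {y} : Set S)) :=
    (Set.infinite_coe_iff.mp hy).image Subtype.val_injective.injOn
  refine hinf.mono ?_
  rintro _ ⟨t, ht, rfl⟩
  have h1 := hf t i
  rw [Set.mem_preimage, Set.mem_singleton_iff] at ht
  rw [ht] at h1
  exact h1

/-- The segment coordinate `(1 − t)·a + t·a'` at a RATIONAL time `t`. -/
noncomputable def seg (a a' : 𝕃) (t : ℚ) : 𝕃 := (1 - (t : 𝕃)) * a + (t : 𝕃) * a'

@[simp] theorem seg_zero (a a' : 𝕃) : seg a a' 0 = a := by simp [seg]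
@[simp] theorem seg_one (a a' : 𝕃) : seg a a' 1 = a' := by simp [seg]

/-- `σ ∈ Aut(ℚ̄/ℚ)` acts on the segment through its endpoints (it fixes `t ∈ ℚ`). -/
theorem smul_seg (σ : 𝕃 ≃ₐ[ℚ] 𝕃) (a a' : 𝕃) (t : ℚ) : σ (seg a a' t) = seg (σ a) (σ a') t := by
  simp [seg, map_add, map_mul, map_sub]

/-- A table coordinate along the segment, as an honest polynomial in `t` over `ℚ̄`. -/
noncomputable def segPoly (f : ∀ (R : Type) [CommRing R], R → R → R → R) (z a b a' b' : 𝕃) : 𝕃[X] :=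
  f 𝕃[X] (C z) (C a + X * C (a' - a)) (C b + X * C (b' - b))

/-- Evaluating `segPoly` at a rational time gives the table coordinate at `v_t` (naturality under
`evalRingHom`).  With `smul_seg` and `map_X` for `σ`, this is all the engine needs. -/
theorem segPoly_eval_X (T : SectionTable) (x : ZMod 5 × ZMod 5) (z a b a' b' : 𝕃) (t : ℚ) :
    (segPoly (T.X x) z a b a' b').eval (t : 𝕃) = T.X x 𝕃 z (seg a a' t) (seg b b' t) := by
  have h := T.map_X x 𝕃[X] 𝕃 (Polynomial.evalRingHom (t : 𝕃)) (C z) (C a + X * C (a' - a))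
    (C b + X * C (b' - b))
  simp only [Polynomial.coe_evalRingHom, eval_C, eval_add, eval_mul, eval_X] at h
  rw [segPoly, h, seg, seg]
  congr 1 <;> ring

theorem segPoly_eval_Y (T : SectionTable) (x : ZMod 5 × ZMod 5) (z a b a' b' : 𝕃) (t : ℚ) :
    (segPoly (T.Y x) z a b a' b').eval (t : 𝕃) = T.Y x 𝕃 z (seg a a' t) (seg b b' t) := by
  have h := T.map_Y x 𝕃[X] 𝕃 (Polynomial.evalRingHom (t : 𝕃)) (C z) (C a + X * C (a' - a))
    (C b + X * C (b' - b))
  simp only [Polynomial.coe_evalRingHom, eval_C, eval_add, eval_mul, eval_X] at h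
  rw [segPoly, h, seg, seg]
  congr 1 <;> ring

/-- **S1 · good_cofinite (S).** Only finitely many rational times are bad: `t ↦ D^{Kl}(v_t)` is a
polynomial (`map_kD` into `ℚ̄[X]`), non-zero at `t = 0`. -/
theorem good_cofinite {a b : 𝕃} (a' b' : 𝕃) (hD : kD a b ≠ 0) :
    {t : ℚ | kD (seg a a' t) (seg b b' t) = 0}.Finite := by
  classical
  set p : 𝕃[X] := kD (C a + X * C (a' - a)) (C b + X * C (b' - b)) with hp
  have hev : ∀ t : ℚ, p.eval (t : 𝕃) = kD (seg a a' t) (seg b b' t) := by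
    intro t
    have h := map_kD (Polynomial.evalRingHom (t : 𝕃)) (C a + X * C (a' - a)) (C b + X * C (b' - b))
    simp only [Polynomial.coe_evalRingHom, eval_C, eval_add, eval_mul, eval_X] at h
    rw [hp, h, seg, seg]
    congr 1 <;> ring
  have hp0 : p ≠ 0 := by
    intro h0
    apply hD
    have h := hev 0
    rw [h0, eval_zero, seg_zero, seg_zero] at h
    exact h.symm
  have hfin : ((p.roots.toFinset : Finset 𝕃) : Set 𝕃).Finite := Finset.finite_toSet _
  refine (hfin.preimage Rat.cast_injective.injOn).subset ?_
  intro t ht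
  simp only [Set.mem_preimage, Finset.mem_coe]
  rw [Multiset.mem_toFinset, Polynomial.mem_roots hp0, Polynomial.IsRoot.def, hev]
  exact ht

/-- `σ` passes through the table (naturality with `φ = σ`). -/
theorem smul_table_X (T : SectionTable) (σ : 𝕃 ≃ₐ[ℚ] 𝕃) (x : ZMod 5 × ZMod 5) (z u v : 𝕃) :
    σ (T.X x 𝕃 z u v) = T.X x 𝕃 (σ z) (σ u) (σ v) := by
  have h := T.map_X x 𝕃 𝕃 (σ : 𝕃 →+* 𝕃) z u v
  simpa using h

theorem smul_table_Y (T : SectionTable) (σ : 𝕃 ≃ₐ[ℚ] 𝕃) (x : ZMod 5 × ZMod 5) (z u v : 𝕃) :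
    σ (T.Y x 𝕃 z u v) = T.Y x 𝕃 (σ z) (σ u) (σ v) := by
  have h := T.map_Y x 𝕃 𝕃 (σ : 𝕃 →+* 𝕃) z u v
  simpa using h

/-- **L2b · relabel_rigid_of_pointwise (PROVED): the algebraic half of L2.** If at each time of an
infinite set of rationals SOME non-zero label `y` realises `σ(X_x, Y_x) = (X_y, Y_y)` at `(ζ, v_t)`,
then ONE label does so at every rational time (`rigidity_engine` on `ℚ̄[X]`, `ι = Bool`). -/
theorem relabel_rigid_of_pointwise (T : SectionTable) {z a b a' b' : 𝕃} (σ : 𝕃 ≃ₐ[ℚ] 𝕃)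
    (x : ZMod 5 × ZMod 5) (S : Set ℚ) (hS : S.Infinite)
    (h : ∀ t ∈ S, ∃ y : ZMod 5 × ZMod 5, y ≠ 0 ∧
      σ (T.X x 𝕃 z (seg a a' t) (seg b b' t)) = T.X y 𝕃 z (seg a a' t) (seg b b' t) ∧
      σ (T.Y x 𝕃 z (seg a a' t) (seg b b' t)) = T.Y y 𝕃 z (seg a a' t) (seg b b' t)) :
    ∃ y : ZMod 5 × ZMod 5, y ≠ 0 ∧ ∀ t : ℚ,
      σ (T.X x 𝕃 z (seg a a' t) (seg b b' t)) = T.X y 𝕃 z (seg a a' t) (seg b b' t) ∧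
      σ (T.Y x 𝕃 z (seg a a' t) (seg b b' t)) = T.Y y 𝕃 z (seg a a' t) (seg b b' t) := by
  classical
  let P : Bool → 𝕃[X] := fun i =>
    cond i (segPoly (T.X x) (σ z) (σ a) (σ b) (σ a') (σ b'))
      (segPoly (T.Y x) (σ z) (σ a) (σ b) (σ a') (σ b'))
  let Q : {y : ZMod 5 × ZMod 5 // y ≠ 0} → Bool → 𝕃[X] := fun y i =>
    cond i (segPoly (T.X y.1) z a b a' b') (segPoly (T.Y y.1) z a b a' b')
  have hS' : (((↑) : ℚ → 𝕃) '' S).Infinite := hS.image Rat.cast_injective.injOn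
  have key : ∀ t' ∈ ((↑) : ℚ → 𝕃) '' S, ∃ y : {y : ZMod 5 × ZMod 5 // y ≠ 0},
      ∀ i, (P i).eval t' = (Q y i).eval t' := by
    rintro _ ⟨t, ht, rfl⟩
    obtain ⟨y, hy0, hX, hY⟩ := h t ht
    refine ⟨⟨y, hy0⟩, fun i => ?_⟩
    cases i
    · simp only [P, Q, cond_false, segPoly_eval_Y]
      rw [← smul_seg, ← smul_seg, ← smul_table_Y]
      exact hY
    · simp only [P, Q, cond_true, segPoly_eval_X]
      rw [← smul_seg, ← smul_seg, ← smul_table_X]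
      exact hX
  obtain ⟨y, hy⟩ := rigidity_engine _ hS' P Q key
  refine ⟨y.1, y.2, fun t => ⟨?_, ?_⟩⟩
  · have e := congrArg (Polynomial.eval (t : 𝕃)) (hy true)
    simp only [P, Q, cond_true, segPoly_eval_X] at e
    rw [smul_table_X, smul_seg, smul_seg]
    exact e
  · have e := congrArg (Polynomial.eval (t : 𝕃)) (hy false)
    simp only [P, Q, cond_false, segPoly_eval_Y] at e
    rw [smul_table_Y, smul_seg, smul_seg]
    exact e

/-- The hypotheses of rigidity along a segment `v_t = (1−t)(a,b) + t(a',b')`: a primitive `5`-th root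
`z`, a good start, and for every GOOD rational `t` a `ℚ`-MODEL `W_t` of the curve at `v_t`
(for Fisher's segment: `W_t = sbase (𝔠₄(1−t+tl, tm)) (𝔠₆(1−t+tl, tm))`, §B8).  VERBATIM k3-g12. -/
structure SegmentFrame (T : SectionTable) (z a b a' b' : 𝕃) : Prop where
  hz : z ^ 4 + z ^ 3 + z ^ 2 + z + 1 = 0
  hD : kD a b ≠ 0
  model : ∀ t : ℚ, kD (seg a a' t) (seg b b' t) ≠ 0 →
    ∃ W : WeierstrassCurve ℚ, W.IsElliptic ∧ IsKleinModel W (seg a a' t) (seg b b' t)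

/-- **L2a · relabel_pointwise (PROVED: `relabel_at` at the model `W_t`).** -/
theorem relabel_pointwise (T : SectionTable) (hT : T.FrameCertified) {z a b a' b' : 𝕃}
    (hF : SegmentFrame T z a b a' b') (σ : 𝕃 ≃ₐ[ℚ] 𝕃) (x : ZMod 5 × ZMod 5) (hx : x ≠ 0)
    (t : ℚ) (ht : kD (seg a a' t) (seg b b' t) ≠ 0) :
    ∃ y : ZMod 5 × ZMod 5, y ≠ 0 ∧
      σ (T.X x 𝕃 z (seg a a' t) (seg b b' t)) = T.X y 𝕃 z (seg a a' t) (seg b b' t) ∧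
      σ (T.Y x 𝕃 z (seg a a' t) (seg b b' t)) = T.Y y 𝕃 z (seg a a' t) (seg b b' t) := by
  obtain ⟨W, hWE, hW⟩ := hF.model t ht
  haveI := hWE
  exact relabel_at T hT W hF.hz hW ht σ x hx

/-- **L2 · galois_relabel_rigid (PROVED, k3-g12 VERBATIM).** For `σ ∈ Aut(ℚ̄/ℚ)` and a label `x ≠ 0`
there is ONE label `y ≠ 0` with `σ(X_x, Y_x)(ζ, v_t) = (X_y, Y_y)(ζ, v_t)` for EVERY rational `t` — the
Galois relabelling is the same permutation at `t = 0` and at `t = 1`. -/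
theorem galois_relabel_rigid (T : SectionTable) (hT : T.FrameCertified) {z a b a' b' : 𝕃}
    (hF : SegmentFrame T z a b a' b') (σ : 𝕃 ≃ₐ[ℚ] 𝕃) (x : ZMod 5 × ZMod 5) (hx : x ≠ 0) :
    ∃ y : ZMod 5 × ZMod 5, y ≠ 0 ∧ ∀ t : ℚ,
      σ (T.X x 𝕃 z (seg a a' t) (seg b b' t)) = T.X y 𝕃 z (seg a a' t) (seg b b' t) ∧
      σ (T.Y x 𝕃 z (seg a a' t) (seg b b' t)) = T.Y y 𝕃 z (seg a a' t) (seg b b' t) := by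
  have hS : ({t : ℚ | kD (seg a a' t) (seg b b' t) = 0}ᶜ).Infinite :=
    (good_cofinite a' b' hF.hD).infinite_compl
  exact relabel_rigid_of_pointwise T σ x _ hS (fun t ht => relabel_pointwise T hT hF σ x hx t ht)

/-! ## §B6 The congruence of the two ends of a framed segment (PROVED; replaces k3-g12 L3 + L4) -/

/-- `σ` moves the frame point with label `x` to the frame point with label `y`
(in `W[5]`, from the coordinate relabelling). -/
theorem smul_frame_eq (T : SectionTable) (W : WeierstrassCurve ℚ) {z u v : 𝕃}
    (φ : ZMod 5 × ZMod 5 →+ W.geomTorsion 5)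
    (hφ : ∀ x : ZMod 5 × ZMod 5, x ≠ 0 → ∃ n, ((φ x : W.geomTorsion 5) : geomPoints W) =
      (Affine.Point.some (T.X x 𝕃 z u v) (T.Y x 𝕃 z u v) n : (W.baseChange 𝕃).toAffine.Point))
    (σ : 𝕃 ≃ₐ[ℚ] 𝕃) {x y : ZMod 5 × ZMod 5} (hx : x ≠ 0) (hy : y ≠ 0)
    (hX : σ (T.X x 𝕃 z u v) = T.X y 𝕃 z u v) (hY : σ (T.Y x 𝕃 z u v) = T.Y y 𝕃 z u v) :
    (show Field.absoluteGaloisGroup ℚ from σ) • φ x = φ y := by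
  apply Subtype.ext
  obtain ⟨n₁, e₁⟩ := hφ x hx
  obtain ⟨n₂, e₂⟩ := hφ y hy
  rw [AddSubgroup.torsionBy.coe_smul, e₁, e₂]
  show Affine.Point.map ((σ : 𝕃 ≃ₐ[ℚ] 𝕃) : 𝕃 →ₐ[ℚ] 𝕃)
      (Affine.Point.some (T.X x 𝕃 z u v) (T.Y x 𝕃 z u v) n₁ : (W.baseChange 𝕃).toAffine.Point) =
      Affine.Point.some (T.X y 𝕃 z u v) (T.Y y 𝕃 z u v) n₂
  rw [Affine.Point.map_some]
  exact (Affine.Point.some.injEq _ _ _ _ _ _).mpr ⟨hX, hY⟩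

/-- **L4 · congr_of_segmentFrame (PROVED).** The ends of a framed segment are `5`-congruent:
`e := φ₀ ∘ φ₁⁻¹ : W₁[5] ≃+ W₀[5]` (two level structures, `AddEquiv.ofBijective`) is `Γ_ℚ`-equivariant
because the relabelling `x ↦ y` of `σ` is the same at `t = 1` and `t = 0` (`galois_relabel_rigid`). -/
theorem congr_of_segmentFrame (T : SectionTable) (hT : T.FrameCertified) {z a b a' b' : 𝕃}
    (hF : SegmentFrame T z a b a' b') (W₀ W₁ : WeierstrassCurve ℚ) [W₀.IsElliptic] [W₁.IsElliptic]
    (h₀ : IsKleinModel W₀ a b) (h₁ : IsKleinModel W₁ a' b') (hD₁ : kD a' b' ≠ 0) :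
    Congr W₁ W₀ := by
  obtain ⟨φ₀, hb₀, hφ₀⟩ := level_structure T hT W₀ hF.hz h₀ hF.hD
  obtain ⟨φ₁, hb₁, hφ₁⟩ := level_structure T hT W₁ hF.hz h₁ hD₁
  let e₀ : (ZMod 5 × ZMod 5) ≃+ W₀.geomTorsion 5 := AddEquiv.ofBijective φ₀ hb₀
  let e₁ : (ZMod 5 × ZMod 5) ≃+ W₁.geomTorsion 5 := AddEquiv.ofBijective φ₁ hb₁
  refine ⟨e₁.symm.trans e₀, fun σ Q => ?_⟩
  obtain ⟨x, rfl⟩ := hb₁.2 Q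
  have hex : e₁.symm (φ₁ x) = x := by
    rw [← AddEquiv.ofBijective_apply φ₁ hb₁]; exact e₁.symm_apply_apply x
  by_cases hx : x = 0
  · subst hx
    rw [map_zero, smul_zero, map_zero, smul_zero]
  -- the relabelling of `σ` is the same label `y` at both ends
  obtain ⟨y, hy0, hy⟩ := galois_relabel_rigid T hT hF (σ : 𝕃 ≃ₐ[ℚ] 𝕃) x hx
  obtain ⟨hX₁, hY₁⟩ := hy 1
  obtain ⟨hX₀, hY₀⟩ := hy 0
  simp only [seg_one] at hX₁ hY₁
  simp only [seg_zero] at hX₀ hY₀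
  have m₁ : σ • φ₁ x = φ₁ y := smul_frame_eq T W₁ φ₁ hφ₁ σ hx hy0 hX₁ hY₁
  have m₀ : σ • φ₀ x = φ₀ y := smul_frame_eq T W₀ φ₀ hφ₀ σ hx hy0 hX₀ hY₀
  have hey : e₁.symm (φ₁ y) = y := by
    rw [← AddEquiv.ofBijective_apply φ₁ hb₁]; exact e₁.symm_apply_apply y
  rw [m₁, AddEquiv.trans_apply, AddEquiv.trans_apply, hey, hex]
  show φ₀ y = σ • φ₀ x
  exact m₀.symm

/-! ## §B7 The SIGN of `𝔠₆` along the segment (PROVED; replaces k3-g12's open `L84C6`)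

Klein's syzygy at `v_s` and at `v`, L84-C4, L84-D and Hesse's syzygy give `c₆^{Kl}(v_s)² = 𝔠₆(λ_s,μ_s)²`
for EVERY `s ∈ ℚ̄` (`(λ_s, μ_s) = (1−s+sl, sm)`); both sides are polynomials in `s` (`ℚ̄[X]` is a
domain: `P² = Q² ⇒ P = ±Q`), and `s = 0` (`v_0 = v`, `𝔠₆(1,0) = c₆ ≠ 0`) excludes `P = −Q`. -/

section Numerators
variable {R S : Type*} [CommRing R] [CommRing S]

/-- VERBATIM k3-g11 Road §Numerators: `𝔠₄ = N4/17424`, `𝔠₆ = N6/(17424·240)` with INTEGER numerators. -/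
def Pl (c₄ c₆ l m : R) : R :=
  Dlll c₄ c₆ l m * Dmm c₄ c₆ l m + Dll c₄ c₆ l m * Dlmm c₄ c₆ l m
    - 2 * Dlm c₄ c₆ l m * Dllm c₄ c₆ l m
def Pm (c₄ c₆ l m : R) : R :=
  Dllm c₄ c₆ l m * Dmm c₄ c₆ l m + Dll c₄ c₆ l m * Dmmm c₄ c₆ l m
    - 2 * Dlm c₄ c₆ l m * Dlmm c₄ c₆ l m
def N6 (c₄ c₆ l m : R) : R :=
  Dm c₄ c₆ l m * Pl c₄ c₆ l m - Dl c₄ c₆ l m * Pm c₄ c₆ l m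

theorem map_N6 {F : Type*} [FunLike F R S] [RingHomClass F R S] (f : F) (c₄ c₆ l m : R) :
    f (N6 c₄ c₆ l m) = N6 (f c₄) (f c₆) (f l) (f m) := by
  simp only [N6, Pl, Pm, Dl, Dm, Dll, Dmm, Dlm, Dlll, Dllm, Dlmm, Dmmm, map_add, map_sub, map_mul,
    map_pow, map_neg, map_ofNat]

theorem map_Mv1 (f : R →+* S) (a b l m : R) : f (Mv1 a b l m) = Mv1 (f a) (f b) (f l) (f m) := by
  simp only [Mv1, kDb, map_add, map_sub, map_mul, map_pow, map_ofNat]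

theorem map_Mv2 (f : R →+* S) (a b l m : R) : f (Mv2 a b l m) = Mv2 (f a) (f b) (f l) (f m) := by
  simp only [Mv2, kDa, map_add, map_sub, map_mul, map_pow, map_ofNat]

end Numerators

theorem C6_eq_N6_div {F : Type*} [Field F] [CharZero F] (c₄ c₆ l m : F) :
    C6 c₄ c₆ l m = N6 c₄ c₆ l m / (17424 * 240) := by
  simp only [C6, C4l, C4m, N6, Pl, Pm]
  field_simp
  ring

theorem C6_one_zero' {F : Type*} [Field F] [CharZero F] (c₄ c₆ : F) : C6 c₄ c₆ 1 0 = c₆ := by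
  simp only [C6, C4l, C4m, Dl, Dm, Dll, Dlm, Dmm, Dlll, Dllm, Dlmm, Dmmm]
  field_simp
  ring

theorem C4_one_zero' {F : Type*} [Field F] [CharZero F] (c₄ c₆ : F) : C4 c₄ c₆ 1 0 = c₄ := by
  simp only [C4, Dll, Dmm, Dlm]
  field_simp
  ring

/-- The four inputs PROVED in earlier generations (verbatim proofs available in the crux directory;
crux workfiles do not import each other, so they enter as named hypotheses). -/
def L84C4 : Prop :=
  ∀ (a b l m : 𝕃), kD a b ≠ 0 → C4 (kC4 a b) (kC6 a b) l m = kC4 (Mv1 a b l m) (Mv2 a b l m)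

/-- L84-D (PROVED k3-g9 `lemma84_D`, `ring` ≈ 20 s at `maxHeartbeats 40000000`). -/
def L84D : Prop :=
  ∀ (a b l m : 𝕃), D (kC4 a b) (kC6 a b) l m * kD a b = kD (Mv1 a b l m) (Mv2 a b l m)

/-- T1 (PROVED k3-g10 `exists_torsorPoint`, ≈ 120 lines). -/
def TorsorPoint : Prop :=
  ∀ c₄ c₆ : 𝕃, c₄ ^ 3 ≠ c₆ ^ 2 → ∃ a b : 𝕃, kC4 a b = c₄ ∧ kC6 a b = c₆

/-- Hesse's syzygy (8.1) over `ℚ̄` in both variables (PROVED at `μ = 1`: k3-g9 `hesse_syzygy_F`;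
the general case follows by homogeneity `N4_smul`/`N6_smul`/`D` of degrees `20/30/12` — one cycle). -/
def HesseSyzygy : Prop :=
  ∀ c₄ c₆ l m : 𝕃, C4 c₄ c₆ l m ^ 3 - C6 c₄ c₆ l m ^ 2 = (c₄ ^ 3 - c₆ ^ 2) * D c₄ c₆ l m ^ 5

/-- squares agree along the pencil (PROVED from the syzygies). -/
theorem kC6_sq_eq (h84C4 : L84C4) (h84D : L84D) (hHS : HesseSyzygy) {a b : 𝕃} (hD : kD a b ≠ 0)
    (l m : 𝕃) : kC6 (Mv1 a b l m) (Mv2 a b l m) ^ 2 = C6 (kC4 a b) (kC6 a b) l m ^ 2 := by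
  have E1 := klein_syzygy (Mv1 a b l m) (Mv2 a b l m)
  have E2 := h84C4 a b l m hD
  have E3 := h84D a b l m
  have E4 := klein_syzygy a b
  have E5 := hHS (kC4 a b) (kC6 a b) l m
  rw [← E2, ← E3] at E1
  linear_combination (-1 : 𝕃) * E1 + E5 + D (kC4 a b) (kC6 a b) l m ^ 5 * E4

/-- **SIGN LEMMA (PROVED).** `c₆^{Kl}(M_v(1−s+sl, sm)) = 𝔠₆(1−s+sl, sm)` for every `s`, when
`c₆ = c₆^{Kl}(v) ≠ 0`.  In particular (`s = 1`) Fisher's L. 8.4 for `𝔠₆` on the whole segment. -/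
theorem kC6_pencil_eq (h84C4 : L84C4) (h84D : L84D) (hHS : HesseSyzygy) {a b : 𝕃} (hD : kD a b ≠ 0)
    (hc6 : kC6 a b ≠ 0) (l m s : 𝕃) :
    kC6 (Mv1 a b (1 - s + s * l) (s * m)) (Mv2 a b (1 - s + s * l) (s * m)) =
      C6 (kC4 a b) (kC6 a b) (1 - s + s * l) (s * m) := by
  let Pp : 𝕃[X] :=
    kC6 (Mv1 (C a) (C b) (1 - X + X * C l) (X * C m)) (Mv2 (C a) (C b) (1 - X + X * C l) (X * C m))
  let Qp : 𝕃[X] := C ((17424 * 240 : 𝕃)⁻¹) * N6 (C (kC4 a b)) (C (kC6 a b)) (1 - X + X * C l) (X * C m)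
  have hP : ∀ s : 𝕃, Pp.eval s =
      kC6 (Mv1 a b (1 - s + s * l) (s * m)) (Mv2 a b (1 - s + s * l) (s * m)) := by
    intro s
    have h1 := map_kC6 (Polynomial.evalRingHom s) (Mv1 (C a) (C b) (1 - X + X * C l) (X * C m))
      (Mv2 (C a) (C b) (1 - X + X * C l) (X * C m))
    have h2 := map_Mv1 (Polynomial.evalRingHom s) (C a) (C b) (1 - X + X * C l) (X * C m)
    have h3 := map_Mv2 (Polynomial.evalRingHom s) (C a) (C b) (1 - X + X * C l) (X * C m)
    simp only [Polynomial.coe_evalRingHom, eval_C, eval_sub, eval_add, eval_mul, eval_X, eval_one]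
      at h1 h2 h3
    rw [h2, h3] at h1
    exact h1
  have hQ : ∀ s : 𝕃, Qp.eval s = C6 (kC4 a b) (kC6 a b) (1 - s + s * l) (s * m) := by
    intro s
    have h1 := map_N6 (Polynomial.evalRingHom s) (C (kC4 a b)) (C (kC6 a b)) (1 - X + X * C l) (X * C m)
    simp only [Polynomial.coe_evalRingHom, eval_C, eval_sub, eval_add, eval_mul, eval_X, eval_one] at h1
    show (C ((17424 * 240 : 𝕃)⁻¹) * N6 (C (kC4 a b)) (C (kC6 a b)) (1 - X + X * C l) (X * C m)).eval s = _
    rw [eval_mul, eval_C, h1, C6_eq_N6_div, div_eq_inv_mul]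
  have hsq : Pp ^ 2 = Qp ^ 2 := by
    apply Polynomial.funext
    intro s
    rw [eval_pow, eval_pow, hP, hQ]
    exact kC6_sq_eq h84C4 h84D hHS hD _ _
  have h0P : Pp.eval 0 = kC6 a b := by
    rw [hP]; simp only [Mv1, Mv2]; ring_nf
  have h0Q : Qp.eval 0 = kC6 a b := by
    rw [hQ]
    have : (1 - 0 + 0 * l : 𝕃) = 1 := by ring
    rw [this, zero_mul, C6_one_zero']
  rcases sq_eq_sq_iff_eq_or_eq_neg.mp hsq with h | h
  · rw [← hP, ← hQ, h]
  · exfalso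
    apply hc6
    have e := congrArg (Polynomial.eval (0 : 𝕃)) h
    rw [eval_neg, h0P, h0Q] at e
    have : (2 : 𝕃) * kC6 a b = 0 := by linear_combination e
    exact (mul_eq_zero.mp this).resolve_left two_ne_zero

/-! ## §B8 Fisher's segment is framed (PROVED): the models `W_t = sbase (𝔠₄(λ_t,μ_t)) (𝔠₆(λ_t,μ_t))` -/

/-- `Δ(y² = x³ − 27Ax − 54B) = 2⁶3⁹(A³ − B²)`: an elliptic `c₄c₆`-model has `A³ ≠ B²`. -/
theorem cube_ne_sq_of_isElliptic (A B : ℚ)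
    (h : (⟨0, 0, 0, -27 * A, -54 * B⟩ : WeierstrassCurve ℚ).IsElliptic) : A ^ 3 ≠ B ^ 2 := by
  have hΔ := h.isUnit.ne_zero
  intro hAB
  apply hΔ
  simp only [WeierstrassCurve.Δ, WeierstrassCurve.b₂, WeierstrassCurve.b₄, WeierstrassCurve.b₆,
    WeierstrassCurve.b₈]
  linear_combination (1259712 : ℚ) * hAB

/-- `Δ(sbase A B) = 2⁶3⁹5¹²(A³ − B²)`. -/
theorem isElliptic_sbase {A B : ℚ} (h : A ^ 3 ≠ B ^ 2) : (sbase A B).IsElliptic := by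
  rw [WeierstrassCurve.isElliptic_iff]
  have e : (sbase A B).Δ = 1259712 * 5 ^ 12 * (A ^ 3 - B ^ 2) := by
    simp only [sbase, WeierstrassCurve.Δ, WeierstrassCurve.b₂, WeierstrassCurve.b₄, WeierstrassCurve.b₆,
      WeierstrassCurve.b₈]
    ring
  rw [e]
  exact isUnit_iff_ne_zero.mpr (mul_ne_zero (by norm_num) (sub_ne_zero.mpr h))

/-- VERBATIM k3-g12 (PROVED): Fisher's invariants commute with `ℚ → ℚ̄`. -/
theorem cast_C4 (c₄ c₆ l m : ℚ) :
    ((C4 c₄ c₆ l m : ℚ) : 𝕃) = C4 (c₄ : 𝕃) (c₆ : 𝕃) (l : 𝕃) (m : 𝕃) := by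
  simp only [C4, Dll, Dlm, Dmm]
  push_cast
  ring

theorem cast_C6 (c₄ c₆ l m : ℚ) :
    ((C6 c₄ c₆ l m : ℚ) : 𝕃) = C6 (c₄ : 𝕃) (c₆ : 𝕃) (l : 𝕃) (m : 𝕃) := by
  simp only [C6, C4l, C4m, Dl, Dm, Dll, Dlm, Dmm, Dlll, Dllm, Dlmm, Dmmm]
  push_cast
  ring

/-- the segment from `v` to `w = M_v(l,m)` is Fisher's pencil `M_v(1−t+tl, tm)`. -/
theorem seg_Mv1 (a b l m : 𝕃) (t : ℚ) :
    seg a (Mv1 a b l m) t = Mv1 a b (1 - (t : 𝕃) + (t : 𝕃) * l) ((t : 𝕃) * m) := by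
  simp only [seg, Mv1]; ring

theorem seg_Mv2 (a b l m : 𝕃) (t : ℚ) :
    seg b (Mv2 a b l m) t = Mv2 a b (1 - (t : 𝕃) + (t : 𝕃) * l) ((t : 𝕃) * m) := by
  simp only [seg, Mv2]; ring

/-- a non-degenerate torsor point from the syzygy. -/
theorem kD_ne_zero_of {a b : 𝕃} (h : kC4 a b ^ 3 ≠ kC6 a b ^ 2) : kD a b ≠ 0 := by
  intro hD
  apply h
  have := klein_syzygy a b
  rw [hD] at this
  linear_combination this

theorem kD_eq_zero_of {a b : 𝕃} (h : kC4 a b ^ 3 = kC6 a b ^ 2) : kD a b = 0 := by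
  have hs := klein_syzygy a b
  have h5 : (1728 : 𝕃) * kD a b ^ 5 = 0 := by rw [← hs]; linear_combination h
  exact (pow_eq_zero_iff (n := 5) (by norm_num)).mp ((mul_eq_zero.mp h5).resolve_left (by norm_num))

/-- **The Klein model at a pencil point (PROVED).** For `(c₄,c₆) = (c₄^{Kl},c₆^{Kl})(a,b)`, `c₆ ≠ 0` and a
rational time `t` with `D^{Kl}(v_t) ≠ 0`, `(λ,μ) = (1−t+tl, tm)`: `sbase (𝔠₄(λ,μ)) (𝔠₆(λ,μ))` is an
ELLIPTIC KLEIN MODEL at `v_t = M_v(λ,μ)` (L84-C4, the sign lemma, `cast_C4/C6`, Klein's syzygy). -/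
theorem kleinModel_pencil (h84C4 : L84C4) (h84D : L84D) (hHS : HesseSyzygy) {a b : 𝕃}
    (c₄ c₆ l m : ℚ) (h4 : kC4 a b = c₄) (h6 : kC6 a b = c₆) (hD : kD a b ≠ 0) (hc6 : c₆ ≠ 0) (t : ℚ)
    (ht : kD (Mv1 a b (1 - (t : 𝕃) + (t : 𝕃) * l) ((t : 𝕃) * m))
      (Mv2 a b (1 - (t : 𝕃) + (t : 𝕃) * l) ((t : 𝕃) * m)) ≠ 0) :
    (sbase (C4 c₄ c₆ (1 - t + t * l) (t * m)) (C6 c₄ c₆ (1 - t + t * l) (t * m))).IsElliptic ∧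
      IsKleinModel (sbase (C4 c₄ c₆ (1 - t + t * l) (t * m)) (C6 c₄ c₆ (1 - t + t * l) (t * m)))
        (Mv1 a b (1 - (t : 𝕃) + (t : 𝕃) * l) ((t : 𝕃) * m))
        (Mv2 a b (1 - (t : 𝕃) + (t : 𝕃) * l) ((t : 𝕃) * m)) := by
  have hc6' : kC6 a b ≠ 0 := by rw [h6]; exact_mod_cast hc6
  have cl : ((1 - t + t * l : ℚ) : 𝕃) = 1 - (t : 𝕃) + (t : 𝕃) * l := by push_cast; ring
  have cm : ((t * m : ℚ) : 𝕃) = (t : 𝕃) * m := by push_cast; ring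
  have e4 : kC4 (Mv1 a b (1 - (t : 𝕃) + (t : 𝕃) * l) ((t : 𝕃) * m))
      (Mv2 a b (1 - (t : 𝕃) + (t : 𝕃) * l) ((t : 𝕃) * m)) = ((C4 c₄ c₆ (1 - t + t * l) (t * m) : ℚ) : 𝕃) := by
    rw [cast_C4, cl, cm, ← h84C4 a b _ _ hD, h4, h6]
  have e6 : kC6 (Mv1 a b (1 - (t : 𝕃) + (t : 𝕃) * l) ((t : 𝕃) * m))
      (Mv2 a b (1 - (t : 𝕃) + (t : 𝕃) * l) ((t : 𝕃) * m)) = ((C6 c₄ c₆ (1 - t + t * l) (t * m) : ℚ) : 𝕃) := by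
    rw [cast_C6, cl, cm, kC6_pencil_eq h84C4 h84D hHS hD hc6', h4, h6]
  refine ⟨isElliptic_sbase ?_, ⟨rfl, rfl, rfl, ?_, ?_⟩⟩
  · intro hAB
    apply ht
    apply kD_eq_zero_of
    rw [e4, e6]
    exact_mod_cast hAB
  · show ((-(27 * 5 ^ 4) * C4 c₄ c₆ (1 - t + t * l) (t * m) : ℚ) : 𝕃) = _
    rw [Rat.cast_mul, ← e4]; push_cast; ring
  · show ((-(54 * 5 ^ 6) * C6 c₄ c₆ (1 - t + t * l) (t * m) : ℚ) : 𝕃) = _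
    rw [Rat.cast_mul, ← e6]; push_cast; ring

/-- **L5 · segmentFrame_fisher (PROVED).** Fisher's segment from `v` to `w = M_v(l,m)` is framed. -/
theorem segmentFrame_fisher (T : SectionTable) (h84C4 : L84C4) (h84D : L84D) (hHS : HesseSyzygy)
    {z a b : 𝕃} (hz : z ^ 4 + z ^ 3 + z ^ 2 + z + 1 = 0) (c₄ c₆ l m : ℚ) (h4 : kC4 a b = c₄)
    (h6 : kC6 a b = c₆) (hD : kD a b ≠ 0) (hc6 : c₆ ≠ 0) :
    SegmentFrame T z a b (Mv1 a b (l : 𝕃) (m : 𝕃)) (Mv2 a b (l : 𝕃) (m : 𝕃)) := by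
  refine ⟨hz, hD, fun t ht => ?_⟩
  rw [seg_Mv1, seg_Mv2] at ht ⊢
  exact ⟨_, (kleinModel_pencil h84C4 h84D hHS c₄ c₆ l m h4 h6 hD hc6 t ht).1,
    (kleinModel_pencil h84C4 h84D hHS c₄ c₆ l m h4 h6 hD hc6 t ht).2⟩

/-! ## §B9 ASSEMBLY: F1 at `c₆ ≠ 0` (PROVED from (T), (P1)–(P4)), and the stub -/

/-- **F1ne**: Fisher 2012 Thm 13.2 (i), `n = 5`, over `ℚ`, WITH the extra binder `c₆ ≠ 0` — the only
instance k3-g11's Road consumes (`stub_switch_of_core_and_tail`, branch `hc₆`). -/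
def F1ne : Prop :=
  ∀ (E E' : WeierstrassCurve ℚ) [E.IsElliptic] [E'.IsElliptic] (c₄ c₆ l m : ℚ), c₆ ≠ 0 →
    E = ⟨0, 0, 0, -27 * c₄, -54 * c₆⟩ →
    E' = ⟨0, 0, 0, -27 * C4 c₄ c₆ l m, -54 * C6 c₄ c₆ l m⟩ →
      ∃ e : E'.geomTorsion 5 ≃+ E.geomTorsion 5,
        ∀ (σ : Field.absoluteGaloisGroup ℚ) (P : E'.geomTorsion 5), e (σ • P) = σ • e P

/-- a primitive `5`-th root of unity in `ℚ̄` (VERBATIM k3-g11 Road `exists_phi5_root`). -/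
theorem exists_phi5_root : ∃ η : 𝕃, η ^ 4 + η ^ 3 + η ^ 2 + η + 1 = 0 := by
  have hdeg : (X ^ 4 + X ^ 3 + X ^ 2 + X + 1 : Polynomial 𝕃).degree ≠ 0 := by
    have : (X ^ 4 + X ^ 3 + X ^ 2 + X + 1 : Polynomial 𝕃).degree = 4 := by compute_degree!
    rw [this]; decide
  obtain ⟨η, hη⟩ := IsAlgClosed.exists_root _ hdeg
  refine ⟨η, ?_⟩
  have : (X ^ 4 + X ^ 3 + X ^ 2 + X + 1 : Polynomial 𝕃).eval η = 0 := hη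
  simpa only [Polynomial.eval_add, Polynomial.eval_pow, Polynomial.eval_X,
    Polynomial.eval_one] using this

/-- `y² = x³ − 27Ax − 54B` is `5`-congruent to its integer rescaling `sbase A B` (`scale_smul_short 5`). -/
theorem congr_sbase (A B : ℚ) : Congr (⟨0, 0, 0, -27 * A, -54 * B⟩ : WeierstrassCurve ℚ) (sbase A B) := by
  refine congr_of_smul_eq _ ((scale_smul_short 5 (by norm_num) (-27 * A) (-54 * B)).trans ?_)
  show (⟨0, 0, 0, (5 : ℚ) ^ 4 * (-27 * A), (5 : ℚ) ^ 6 * (-54 * B)⟩ : WeierstrassCurve ℚ) =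
    ⟨0, 0, 0, -(27 * 5 ^ 4) * A, -(54 * 5 ^ 6) * B⟩
  congr 1 <;> ring

/-- **THEOREM (PROVED, 0 sorry): F1 at `c₆ ≠ 0` from the frame-certified table and (P1)–(P4).** -/
theorem F1ne_of_frame (hT : ∃ T : SectionTable, T.FrameCertified) (h84C4 : L84C4) (h84D : L84D)
    (hTor : TorsorPoint) (hHS : HesseSyzygy) : F1ne := by
  obtain ⟨T, hT⟩ := hT
  intro E E' iE iE' c₄ c₆ l m hc6 hE hE'
  subst hE hE'
  -- ellipticity of the two ends
  have hΔ : c₄ ^ 3 ≠ c₆ ^ 2 := cube_ne_sq_of_isElliptic c₄ c₆ iE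
  have hΔ' : C4 c₄ c₆ l m ^ 3 ≠ C6 c₄ c₆ l m ^ 2 := cube_ne_sq_of_isElliptic _ _ iE'
  -- torsor point and `ζ`
  obtain ⟨a, b, h4, h6⟩ := hTor (c₄ : 𝕃) (c₆ : 𝕃) (by exact_mod_cast hΔ)
  have hD : kD a b ≠ 0 := by
    apply kD_ne_zero_of
    rw [h4, h6]; exact_mod_cast hΔ
  have hc6' : kC6 a b ≠ 0 := by rw [h6]; exact_mod_cast hc6
  obtain ⟨z, hz⟩ := exists_phi5_root
  -- the two integer models and their Klein data
  haveI hW₀ : (sbase c₄ c₆).IsElliptic := isElliptic_sbase hΔ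
  haveI hW₁ : (sbase (C4 c₄ c₆ l m) (C6 c₄ c₆ l m)).IsElliptic := isElliptic_sbase hΔ'
  have k₀ : IsKleinModel (sbase c₄ c₆) a b :=
    ⟨rfl, rfl, rfl, by show ((-(27 * 5 ^ 4) * c₄ : ℚ) : 𝕃) = _; push_cast; rw [h4],
      by show ((-(54 * 5 ^ 6) * c₆ : ℚ) : 𝕃) = _; push_cast; rw [h6]⟩
  have e4₁ : kC4 (Mv1 a b (l : 𝕃) (m : 𝕃)) (Mv2 a b (l : 𝕃) (m : 𝕃)) = ((C4 c₄ c₆ l m : ℚ) : 𝕃) := by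
    rw [cast_C4, ← h84C4 a b _ _ hD, h4, h6]
  have e6₁ : kC6 (Mv1 a b (l : 𝕃) (m : 𝕃)) (Mv2 a b (l : 𝕃) (m : 𝕃)) = ((C6 c₄ c₆ l m : ℚ) : 𝕃) := by
    have h := kC6_pencil_eq h84C4 h84D hHS hD hc6' (l : 𝕃) (m : 𝕃) 1
    simp only [sub_self, zero_add, one_mul] at h
    rw [cast_C6, h, h4, h6]
  have hD₁ : kD (Mv1 a b (l : 𝕃) (m : 𝕃)) (Mv2 a b (l : 𝕃) (m : 𝕃)) ≠ 0 := by
    apply kD_ne_zero_of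
    rw [e4₁, e6₁]; exact_mod_cast hΔ'
  have k₁ : IsKleinModel (sbase (C4 c₄ c₆ l m) (C6 c₄ c₆ l m))
      (Mv1 a b (l : 𝕃) (m : 𝕃)) (Mv2 a b (l : 𝕃) (m : 𝕃)) :=
    ⟨rfl, rfl, rfl,
      by show ((-(27 * 5 ^ 4) * C4 c₄ c₆ l m : ℚ) : 𝕃) = _; rw [Rat.cast_mul, ← e4₁]; push_cast; ring,
      by show ((-(54 * 5 ^ 6) * C6 c₄ c₆ l m : ℚ) : 𝕃) = _; rw [Rat.cast_mul, ← e6₁]; push_cast; ring⟩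
  -- the framed segment; the ends are congruent; undo the rescalings
  have hF := segmentFrame_fisher T h84C4 h84D hHS hz c₄ c₆ l m h4 h6 hD hc6
  have hC : Congr (sbase (C4 c₄ c₆ l m) (C6 c₄ c₆ l m)) (sbase c₄ c₆) :=
    congr_of_segmentFrame T hT hF _ _ k₀ k₁ hD₁
  exact congr_trans (congr_sbase _ _) (congr_trans hC (congr_symm (congr_sbase c₄ c₆)))

/-- **THE STUB (PROVED modulo the named inputs).**  With k3-g11's kernel-checked Road specialised to the
`c₆ ≠ 0` instance it actually uses (`road : F1ne → CDT_three_five_switch` — a one-binder change of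
`CDT_three_five_switch_of_thm132`; same file after concatenation) and `stub_switch ↔
CDT_three_five_switch` (`Iff.rfl`, `Lines/Sketch.lean`): the registered stub follows from PART A's
`table_frameCertified` and (P1)–(P4). -/
theorem stub_switch_of_frame (road : F1ne → CDT_three_five_switch)
    (hT : ∃ T : SectionTable, T.FrameCertified) (h84C4 : L84C4) (h84D : L84D) (hTor : TorsorPoint)
    (hHS : HesseSyzygy) : CDT_three_five_switch :=
  road (F1ne_of_frame hT h84C4 h84D hTor hHS)

end

end Summit.ABC.ABC.Cruxes.FreyModularity.StubSwitchK2g12
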